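import Summits.QuantumFields.BalabanUV.T4Continuum.Support.B13StepTermSocket
import Summits.QuantumFields.BalabanUV.T4Continuum.Support.B13TermRep

/-!
# NE5 ∕ U3 — row O1-d3: the combinatorial-convergence binder of `B13TermRep` IN THE PRINTED LEVELWISE FORM for the labels
# indexing of record (`B13StepTermSocket.labelsIndexing`, leaf-02): `Σ' i, actMajorant … k X i = Σ' n, Σ_{(Z₀,…,Zₙ)} |ρᵀ(Z)|∕(n+1)!
# · Π_m w(Z_m)` with the polymer weight `w(Z) = Σ_{ℓ ∈ innerLabels k Z} A Z ℓ` — so that a per-level bound of the (2.39)–(2.41) ∕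
# [Dimock2013] App. B step 4 kind closes `TermRep` and the per-domain class bound for every model built on the socket

Cell `pub-balaban`, unit `b2b-balaban-t4-ne5-formalise-leaf-04` (NE5 formalisation swarm, LEAF PROVER 04; claim table
`t4/b2b-balaban-t4-ne5-p1/O1-CLAIM-TABLE-NE5-P1.md` row O1-d, part d3).  Summits-side new work under the LEAN PLACEMENT RULE (cell
bookkeeping; NOT a Literature module).  HONEST FRAMING: rung (B)+1 of the FINITE-VOLUME T⁴ continuum programme — NOT infinite volume,
NOT a mass gap, NOT the Clay problem, NOT a proof of NE5 (NOT PRINTED in [Balaban1987RG1]–[Balaban1989LargeFieldII]; they print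
ε-UNIFORM bounds, never η-RATES).  HONEST DEPENDENCY (cell line, verbatim): continuum YM on T⁴ ⇐ BetaPertH ∧ nine spine estimates
(0/9 proved); BetaPertH ⇐ (D1) ∧ (D4) ∧ CAP+tail; G-an2-4 gates asym, D1 and NE2/3/4.

WHAT THIS FILE DOES.  `B13TermRep.termRep_b13_of_actBound` ∕ `classBound_b13_of_actBound` (leaf-04, p208307) reduce row O1-d3 for the
B13 family to an ACTIVITY majorant `A` (the (2.38)-shape) and the summability ∕ per-domain budget of the induced combinatorial
majorant `actMajorant 𝒯 inc A k X : ι → ℝ` — an abstract `tsum` over the term index.  For the indexing of record `𝒯 := labelsIndexing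
G D`, `inc := touchInc G` (leaf-02's `B13StepTermSocket`, p208148, over route P2's `DomainGeometry` and leaf-02's label catalogues
`B13StepTermLabels`, p207773) this file rewrites that binder in the LEVELWISE form in which print states the convergence of (2.13)
([Balaban1988RG2Cluster] p. 20 *"each factor |H(Z)| is replaced by the right-hand side of (2.38)"*, (2.39)–(2.41) p. 21; [Dimock2013]
App. B step 4: a bound per number of factors `n`, then the sum over `n` — locators only, nothing asserted):
* `polyWeight D A k Z := Σ_{ℓ ∈ innerLabels D k Z} A Z ℓ` (the majorant of the ACTIVITY `H(Z) = Σ_ℓ act Z ℓ` induced by the per-term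
  majorant `A`) and `levelMajorant G D A k X n := Σ_{Z ∈ polyTuples G k X n} |ρᵀ(Z)|∕(n+1)! · Π_m polyWeight D A k (Z m)`;
* `sum_actMajorant_termLabels`: the level-`n` slice `Σ_{t ∈ termLabels G D k X n} actMajorant … k X ⟨n, t⟩ = levelMajorant … n`
  (leaf-02's `sum_termLabels_eq_sum_polyTuples` read over `ℝ`, and `‖coeff t‖ = |ρᵀ(Z(t))|∕(n+1)!`);
* `summable_actMajorant_of_levelwise` ∕ `tsum_actMajorant_eq_levelwise`: for `A ≥ 0`, summability of the level majorants in `n`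
  gives summability of `actMajorant` on the term index and `Σ' i, actMajorant … i = Σ' n, levelMajorant … n` (`summable_sigma_of_nonneg`,
  `Summable.tsum_sigma'`; off the localizing labels the majorant vanishes);
* the payoff for ANY step model built on the socket (`M.Out = out (labelsIndexing G D) (touchInc G) act`, e.g. O1-e's
  `Assembly.step` with these fields): `termRep_socket_of_levelBound` (activity majorant on the class + `Summable (levelMajorant …)` per
  step-`k` domain ⟹ `TermRep`) and `classBound_socket_of_levelBudget` (+ `Σ' n, levelMajorant … n ≤ G′·e^{−κd(X)}` ⟹ `ClassBound`).
What remains displayed is thus LITERALLY a per-`n` estimate of `Σ_{(Z₀,…,Zₙ): ∪Z_m = X} |ρᵀ|∕(n+1)!·Π w(Z_m)` summed over `n` — the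
tree-graph summation the tree's kernels (`Dimock2011to13.UrsellTreeGraphBound.abs_hcUrsell_le_card_treeGraphs`, `CayleyDegreeFormula`)
are being assembled to deliver (template lineage, in progress; NOT claimed here).  0 sorry; no new axioms.
-/

noncomputable section

open scoped BigOperators

namespace Summit.QuantumFields.BalabanUV.T4Continuum.B13ActMajorantLevels

open Literature.MathematicalPhysics.QuantumFieldTheory.Balaban1983to89.T4OutputRate (Carriers)
open Literature.MathematicalPhysics.QuantumFieldTheory.Balaban1983to89.T4InputCauchyRateData (StepModel)
open Literature.MathematicalPhysics.QuantumFieldTheory.Balaban1983to89.T4InputCauchyRateSpecies (ClassBound)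
open Literature.MathematicalPhysics.QuantumFieldTheory.Balaban1983to89.T4InputCauchyRateTermwise (TermRep)
open Summit.QuantumFields.BalabanUV.T4Continuum.ClusterRepOfDomains (DomainGeometry)
open Summit.QuantumFields.BalabanUV.T4Continuum.B13StepTermLabels
  (InnerLabel PolyLabel TermIdx InnerData innerLabels polyTuples termLabels mem_termLabels rhoT
    sum_termLabels_eq_sum_polyTuples)
open Summit.QuantumFields.BalabanUV.T4Continuum.B13StepTermFamily (term out)
open Summit.QuantumFields.BalabanUV.T4Continuum.B13StepTermSocket
  (labelsIndexing touchInc rel_iff coeff_eq)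
open Summit.QuantumFields.BalabanUV.T4Continuum.B13TermRep
  (actMajorant actMajorant_of_rel actMajorant_of_not_rel actMajorant_nonneg termRep_b13_of_actBound classBound_b13_of_actBound)

variable {C : Carriers} [DecidableEq C.Dom] {Cube : Type*} [DecidableEq Cube] {Bnd : Type*} [DecidableEq Bnd]
  (G : DomainGeometry C Cube) (D : InnerData C Bnd)

/-! ## §1 The polymer weight and the level majorants -/

/-- [folklore] The POLYMER WEIGHT induced by a per-term activity majorant `A`: `w(Z) = Σ_{ℓ ∈ innerLabels D k Z} A Z ℓ` — the
majorant of the activity `H(Z) = Σ_ℓ act Z ℓ` ([Balaban1988RG2Cluster] (2.9) p. 14; the SHAPE of Lemma 3 (2.38) p. 20 is a bound on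
this sum — locator only). -/
def polyWeight (A : C.Dom → InnerLabel C.Dom Bnd → ℝ) (k : ℕ) (Z : C.Dom) : ℝ := ∑ ℓ ∈ innerLabels D k Z, A Z ℓ

/-- [folklore] THE LEVEL-`n` COMBINATORIAL MAJORANT at the step-`k` domain `X`: the sum over the ordered `(n+1)`-tuples of step-`k`
polymers covering `X` of `|ρᵀ(Z₀,…,Zₙ)|∕(n+1)!` times the product of the polymer weights — the `n`-th term of the majorant series
of (2.13) with *"each factor |H(Z)| replaced by"* its bound (p. 20). -/
def levelMajorant (A : C.Dom → InnerLabel C.Dom Bnd → ℝ) (k : ℕ) (X : C.Dom) (n : ℕ) : ℝ :=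
  ∑ Z ∈ polyTuples G k X n, |(rhoT G Z : ℝ)| / ((n + 1).factorial : ℝ) * ∏ m, polyWeight D A k (Z m)

variable {G D}

omit [DecidableEq Cube] in
/-- [folklore] The polymer weight is nonnegative for a nonnegative activity majorant. -/
theorem polyWeight_nonneg {A : C.Dom → InnerLabel C.Dom Bnd → ℝ} (hA : ∀ Z ℓ, 0 ≤ A Z ℓ) (k : ℕ) (Z : C.Dom) :
    0 ≤ polyWeight D A k Z :=
  Finset.sum_nonneg fun ℓ _ => hA Z ℓ

/-- [folklore] The level majorants are nonnegative for a nonnegative activity majorant. -/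
theorem levelMajorant_nonneg {A : C.Dom → InnerLabel C.Dom Bnd → ℝ} (hA : ∀ Z ℓ, 0 ≤ A Z ℓ) (k : ℕ) (X : C.Dom) (n : ℕ) :
    0 ≤ levelMajorant G D A k X n :=
  Finset.sum_nonneg fun Z _ => mul_nonneg (div_nonneg (abs_nonneg _) (Nat.cast_nonneg _))
    (Finset.prod_nonneg fun m _ => polyWeight_nonneg hA k (Z m))

/-! ## §2 The level-`n` slice of the combinatorial majorant of `B13TermRep` on the labels indexing -/

/-- [folklore] The norm of the socket's coefficient at a label with `n + 1` factors is `|ρᵀ(Z(t))|∕(n+1)!` (leaf-02's `coeff_eq`). -/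
theorem norm_coeff_labelsIndexing (n : ℕ) (t : Fin (n + 1) → PolyLabel C.Dom Bnd) :
    ‖B13StepTermFamily.coeff (labelsIndexing G D) (touchInc G) (⟨n, t⟩ : TermIdx C.Dom Bnd)‖ =
      |(rhoT G (fun i => (t i).Z) : ℝ)| / ((n + 1).factorial : ℝ) := by
  rw [coeff_eq, Complex.norm_real, Real.norm_eq_abs, B13StepTermLabels.coeff, abs_div, Nat.abs_cast]
  rfl

/-- [folklore] leaf-02's product-of-sums identity `sum_termLabels_eq_sum_polyTuples`, read over `ℝ` (by casting to `ℂ`). -/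
theorem sum_termLabels_eq_sum_polyTuples_real (k : ℕ) (X : C.Dom) (n : ℕ) (c : (Fin (n + 1) → C.Dom) → ℝ)
    (φ : PolyLabel C.Dom Bnd → ℝ) :
    ∑ t ∈ termLabels G D k X n, c (fun i => (t i).Z) * ∏ i, φ (t i) =
      ∑ Z ∈ polyTuples G k X n, c Z * ∏ i, ∑ ℓ ∈ innerLabels D k (Z i), φ ⟨Z i, ℓ⟩ := by
  have h := sum_termLabels_eq_sum_polyTuples G D k X n (fun Z => ((c Z : ℝ) : ℂ)) (fun p => ((φ p : ℝ) : ℂ))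
  exact_mod_cast h

/-- [folklore] **THE LEVEL-`n` SLICE**: at a step-`k` domain `X`, the sum of `actMajorant (labelsIndexing G D) (touchInc G) A k X`
over the labels with `n + 1` factors localizing at `X` IS the level majorant `levelMajorant G D A k X n`. -/
theorem sum_actMajorant_termLabels (A : C.Dom → InnerLabel C.Dom Bnd → ℝ) {k : ℕ} {X : C.Dom} (hX : C.scale X = k) (n : ℕ) :
    ∑ t ∈ termLabels G D k X n, actMajorant (labelsIndexing G D) (touchInc G) A k X ⟨n, t⟩ = levelMajorant G D A k X n := by
  have hrel : ∀ t ∈ termLabels G D k X n, (labelsIndexing G D).Rel k (⟨n, t⟩ : TermIdx C.Dom Bnd) X :=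
    fun t ht => (rel_iff G D).2 ⟨hX, (mem_termLabels G D).1 ht⟩
  calc ∑ t ∈ termLabels G D k X n, actMajorant (labelsIndexing G D) (touchInc G) A k X ⟨n, t⟩
      = ∑ t ∈ termLabels G D k X n,
          (fun Z : Fin (n + 1) → C.Dom => |(rhoT G Z : ℝ)| / ((n + 1).factorial : ℝ)) (fun i => (t i).Z) *
            ∏ i, (fun p : PolyLabel C.Dom Bnd => A p.Z p.inner) (t i) := by
        refine Finset.sum_congr rfl fun t ht => ?_
        rw [actMajorant_of_rel (hrel t ht), norm_coeff_labelsIndexing]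
        rfl
    _ = ∑ Z ∈ polyTuples G k X n, (fun Z : Fin (n + 1) → C.Dom => |(rhoT G Z : ℝ)| / ((n + 1).factorial : ℝ)) Z *
          ∏ i, ∑ ℓ ∈ innerLabels D k (Z i), (fun p : PolyLabel C.Dom Bnd => A p.Z p.inner) ⟨Z i, ℓ⟩ :=
        sum_termLabels_eq_sum_polyTuples_real k X n (fun Z => |(rhoT G Z : ℝ)| / ((n + 1).factorial : ℝ))
          (fun p => A p.Z p.inner)
    _ = levelMajorant G D A k X n := rfl

/-- [folklore] Off the catalogue of level `n` the combinatorial majorant vanishes (the label does not localize at `X`). -/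
theorem actMajorant_eq_zero_of_not_mem (A : C.Dom → InnerLabel C.Dom Bnd → ℝ) {k : ℕ} {X : C.Dom} {n : ℕ}
    {t : Fin (n + 1) → PolyLabel C.Dom Bnd} (ht : t ∉ termLabels G D k X n) :
    actMajorant (labelsIndexing G D) (touchInc G) A k X ⟨n, t⟩ = 0 :=
  actMajorant_of_not_rel fun h => ht ((mem_termLabels G D).2 ((rel_iff G D).1 h).2)

/-! ## §3 Summability and the `tsum` of the combinatorial majorant from the level majorants -/

/-- [folklore] **SUMMABILITY FROM THE LEVELS**: for a nonnegative activity majorant, if the level majorants at the step-`k` domain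
`X` are summable in `n`, then `actMajorant (labelsIndexing G D) (touchInc G) A k X` is summable on the term index
(`summable_sigma_of_nonneg`: every level is a finite sum, and the level sums are the level majorants). -/
theorem summable_actMajorant_of_levelwise {A : C.Dom → InnerLabel C.Dom Bnd → ℝ} (hA : ∀ Z ℓ, 0 ≤ A Z ℓ) {k : ℕ} {X : C.Dom}
    (hX : C.scale X = k) (hlev : Summable (levelMajorant G D A k X)) :
    Summable (actMajorant (labelsIndexing G D) (touchInc G) A k X) := by
  refine (summable_sigma_of_nonneg fun t => actMajorant_nonneg hA k X t).2 ⟨fun n => ?_, ?_⟩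
  · exact summable_of_ne_finset_zero (s := termLabels G D k X n) fun t ht => actMajorant_eq_zero_of_not_mem A ht
  · have heq : (fun n => ∑' t : Fin (n + 1) → PolyLabel C.Dom Bnd,
        actMajorant (labelsIndexing G D) (touchInc G) A k X ⟨n, t⟩) = levelMajorant G D A k X := by
      funext n
      rw [tsum_eq_sum (s := termLabels G D k X n) fun t ht => actMajorant_eq_zero_of_not_mem A ht,
        sum_actMajorant_termLabels A hX n]
    rw [heq]
    exact hlev

/-- [folklore] **THE `tsum` BY LEVELS**: under the same hypotheses `Σ' i, actMajorant … k X i = Σ' n, levelMajorant G D A k X n`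
(`Summable.tsum_sigma'`). -/
theorem tsum_actMajorant_eq_levelwise {A : C.Dom → InnerLabel C.Dom Bnd → ℝ} (hA : ∀ Z ℓ, 0 ≤ A Z ℓ) {k : ℕ} {X : C.Dom}
    (hX : C.scale X = k) (hlev : Summable (levelMajorant G D A k X)) :
    ∑' i, actMajorant (labelsIndexing G D) (touchInc G) A k X i = ∑' n, levelMajorant G D A k X n := by
  have hs := summable_actMajorant_of_levelwise hA hX hlev
  have hlevel : ∀ n, Summable fun t : Fin (n + 1) → PolyLabel C.Dom Bnd =>
      actMajorant (labelsIndexing G D) (touchInc G) A k X ⟨n, t⟩ :=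
    fun n => summable_of_ne_finset_zero (s := termLabels G D k X n) fun t ht => actMajorant_eq_zero_of_not_mem A ht
  rw [hs.tsum_sigma' hlevel]
  refine tsum_congr fun n => ?_
  rw [tsum_eq_sum (s := termLabels G D k X n) fun t ht => actMajorant_eq_zero_of_not_mem A ht,
    sum_actMajorant_termLabels A hX n]

/-- [folklore] The per-domain BUDGET transfers from the levels: `Σ' n, levelMajorant … n ≤ B ⟹ Σ' i, actMajorant … i ≤ B`. -/
theorem tsum_actMajorant_le_of_levelwise {A : C.Dom → InnerLabel C.Dom Bnd → ℝ} (hA : ∀ Z ℓ, 0 ≤ A Z ℓ) {k : ℕ} {X : C.Dom}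
    (hX : C.scale X = k) {B : ℝ} (hlev : Summable (levelMajorant G D A k X)) (hB : ∑' n, levelMajorant G D A k X n ≤ B) :
    ∑' i, actMajorant (labelsIndexing G D) (touchInc G) A k X i ≤ B :=
  (tsum_actMajorant_eq_levelwise hA hX hlev).le.trans hB

/-! ## §4 The payoff: `TermRep` and the per-domain class bound for models on the socket, from LEVELWISE binders -/

section Payoff

variable {Op Hist : Type*} [NormedAddCommGroup Op] [NormedSpace ℂ Op] [NormedAddCommGroup Hist] [NormedSpace ℂ Hist]
  (act : C.Dom → InnerLabel C.Dom Bnd → Op → Hist → ℂ)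

/-- [folklore] **ROW O1-d3 ON THE SOCKET FROM LEVELWISE BINDERS.**  For a step model with `M.Out = out (labelsIndexing G D)
(touchInc G) act`: (i) a nonnegative ACTIVITY-TERM majorant `A k g U` on the class — every factor of every tuple localizing at a
step-`k` domain has `‖act Z ℓ q.1 q.2‖ ≤ A k g U Z ℓ` ((2.38)-shape per resummed term; displayed); (ii) at every step-`k` domain the
LEVEL MAJORANTS are summable in the number of factors, `Summable (levelMajorant G D (A k g U) k X)` ((2.39)–(2.41)-shape: a bound
per `n`, summed over `n`; displayed) ⟹ `TermRep M K (term (labelsIndexing G D) (touchInc G) act) W`. -/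
theorem termRep_socket_of_levelBound {M : StepModel C Op Hist}
    (hM : ∀ k o h X, M.Out k o h X = out (labelsIndexing G D) (touchInc G) act k o h X)
    {K : ℕ → (ℕ → ℝ) → C.BgB → Set (Op × Hist)} {W : Set (ℕ → ℝ)}
    {A : ℕ → (ℕ → ℝ) → C.BgB → C.Dom → InnerLabel C.Dom Bnd → ℝ} (hA0 : ∀ k g U Z ℓ, 0 ≤ A k g U Z ℓ)
    (hA : ∀ k, ∀ g ∈ W, ∀ (U : C.BgB) (q : Op × Hist), q ∈ K k g U → ∀ X : C.Dom, C.scale X = k →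
      ∀ i : TermIdx C.Dom Bnd, (labelsIndexing G D).Rel k i X →
        ∀ m, ‖act ((labelsIndexing G D).poly i m) ((labelsIndexing G D).lab i m) q.1 q.2‖ ≤
          A k g U ((labelsIndexing G D).poly i m) ((labelsIndexing G D).lab i m))
    (hlev : ∀ k, ∀ g ∈ W, ∀ (U : C.BgB) (X : C.Dom), C.scale X = k → Summable (levelMajorant G D (A k g U) k X)) :
    TermRep M K (term (labelsIndexing G D) (touchInc G) act) W :=
  termRep_b13_of_actBound (labelsIndexing G D) (touchInc G) act hM hA fun k g hg U X hX =>
    summable_actMajorant_of_levelwise (hA0 k g U) hX (hlev k g hg U X hX)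

/-- [folklore] **THE PER-DOMAIN CLASS BOUND ON THE SOCKET FROM A LEVELWISE BUDGET**: (i) as above and (iii) at every step-`k`
domain `Summable (levelMajorant …) ∧ Σ' n, levelMajorant G D (A k g U) k X n ≤ G′·e^{−κd(X)}` (the per-X form in which (2.41)
p. 21 is printed; displayed) ⟹ `ClassBound M K W κ G′`. -/
theorem classBound_socket_of_levelBudget {M : StepModel C Op Hist}
    (hM : ∀ k o h X, M.Out k o h X = out (labelsIndexing G D) (touchInc G) act k o h X)
    {K : ℕ → (ℕ → ℝ) → C.BgB → Set (Op × Hist)} {W : Set (ℕ → ℝ)}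
    {A : ℕ → (ℕ → ℝ) → C.BgB → C.Dom → InnerLabel C.Dom Bnd → ℝ} (hA0 : ∀ k g U Z ℓ, 0 ≤ A k g U Z ℓ) {κ G' : ℝ}
    (hA : ∀ k, ∀ g ∈ W, ∀ (U : C.BgB) (q : Op × Hist), q ∈ K k g U → ∀ X : C.Dom, C.scale X = k →
      ∀ i : TermIdx C.Dom Bnd, (labelsIndexing G D).Rel k i X →
        ∀ m, ‖act ((labelsIndexing G D).poly i m) ((labelsIndexing G D).lab i m) q.1 q.2‖ ≤
          A k g U ((labelsIndexing G D).poly i m) ((labelsIndexing G D).lab i m))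
    (hbud : ∀ k, ∀ g ∈ W, ∀ (U : C.BgB) (X : C.Dom), C.scale X = k →
      Summable (levelMajorant G D (A k g U) k X) ∧
        ∑' n, levelMajorant G D (A k g U) k X n ≤ G' * Real.exp (-(κ * C.d X))) :
    ClassBound M K W κ G' :=
  classBound_b13_of_actBound (M := M) hM hA fun k g hg U X hX =>
    ⟨summable_actMajorant_of_levelwise (hA0 k g U) hX (hbud k g hg U X hX).1,
      tsum_actMajorant_le_of_levelwise (hA0 k g U) hX (hbud k g hg U X hX).1 (hbud k g hg U X hX).2⟩

end Payoff

end Summit.QuantumFields.BalabanUV.T4Continuum.B13ActMajorantLevels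

end
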